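import Summits.Ventures.Crystal3D.Theorems.StickyWulffConstantCoaxialWallLawKFoldTopFull
import Summits.Ventures.Crystal3D.Theorems.StickyWulffConstantGenericWallFloorStarPairCoaxial
import HarnessLib

/-!
# The k-fold-top census WITHOUT GLIDE arrivals is the stars-only input `StarPairCoaxial` (all `k`)

HONEST FRAMING. Part of the venture `Summits/Ventures/Crystal3D` (cell `crystal3d-full`), helper for the crux
`CoaxialWallLaw` (stmt-Ventures-19481) of `route-Ventures-StickyWulffConstant`, REGISTERED line `WallLedgerF`
(planner cf-p1 gen 16), open stub `stub_coaxialTwoSlabAdhesion` (general fillings).  Rung credit only; F-C1 not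
moved.  Sequel of `…KFoldTopFull` (all-full-shell families ⇐ `DoubleTopFar`): the census target `KFoldTopDeficit`
(`…KFoldTop`) restricted to families WITHOUT GLIDE-TYPE arrivals — every predecessor has a full shell, or reads as
a twin dozen of `(A, n)` with the arrival slot on the NEGATIVE side `⟪A u, n⟫ < 0` (a CROSS arrival) — follows for
EVERY `k` from the stars-only input `StarPairCoaxial` (`…GenericWallFloorStarPairCoaxial`, 19480 lane / lit g13:
«two owned closed `C12` vertex stars at a ball with an eleventh contact off them have co-axial lattices»; its
computational halves are the certified R39d/R41e family).  Reason: a cross arrival, like a full one, hands the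
target the OWNED closed `C12` star of the arrival slot (`b + A w ∈ X` for `⟪w, u⟫ < 0`: the slots `u + w` lie in
the own closed half since `⟪A u, n⟫ = −√(2/3)`), so `cover_of_starPair` + `coaxial_of_starSet_eq` +
19480-p2's `card_contacts_add_card_le_twelve` apply verbatim.  Hence the ONLY rows of `KFoldTopDeficit` not
reduced to `StarPairCoaxial` are those containing a GLIDE-type arrival (the equatorial `A12` star, SLOTEX A12-583
— cf-p2 03:20Z; lit g13's rows (C,G), (G,G), census j298595).

* **`kFoldTop_noGlide_of_starPairCoaxial`** — `StarPairCoaxial` ⇒ `deg b + k ≤ 12` for every family of `k ≥ 2`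
  arrival data with distinct predecessors, pairwise non-co-axial frames, and no glide-type arrival.

WHAT THIS IS NOT: not `KFoldTopDeficit` (glide arrivals excluded); `StarPairCoaxial` is an INPUT; not the stub;
F-C1 not moved.
-/

noncomputable section

namespace Summit.Ventures.Crystal3D.Theorems

open Summit.Ventures.Crystal3D Finset
open Literature.MathematicalPhysics.StatisticalMechanics (fccStacking barlowStacking IsHaggSeq)
open scoped InnerProductSpace

open scoped Classical in
/-- **`StarPairCoaxial` ⇒ the no-glide case of `KFoldTopDeficit`, for every `k`.**  See the module docstring. -/
theorem kFoldTop_noGlide_of_starPairCoaxial (hSP : StarPairCoaxial)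
    (X : Finset (EuclideanSpace ℝ (Fin 3))) (hX : ∀ p ∈ X, ∀ q ∈ X, p ≠ q → 1 ≤ dist p q)
    (b : EuclideanSpace ℝ (Fin 3)) (hb : b ∈ X)
    (S : Finset ((EuclideanSpace ℝ (Fin 3) ≃ₗᵢ[ℝ] EuclideanSpace ℝ (Fin 3)) × EuclideanSpace ℝ (Fin 3)))
    (h2 : 2 ≤ S.card)
    (hS : ∀ s ∈ S, s.2 ∈ fccSlots ∧ b - s.1 s.2 ∈ X)
    (hread : ∀ s ∈ S, (∀ w ∈ fccSlots, b - s.1 s.2 + s.1 w ∈ X) ∨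
      ∃ n : EuclideanSpace ℝ (Fin 3), ‖n‖ = 1 ∧
        (∀ w ∈ fccSlots, ⟪s.1 w, n⟫_ℝ = 0 ∨ ⟪s.1 w, n⟫_ℝ = Real.sqrt (2 / 3) ∨ ⟪s.1 w, n⟫_ℝ = -Real.sqrt (2 / 3)) ∧
        (∀ w ∈ fccSlots, ⟪s.1 w, n⟫_ℝ ≤ 0 → b - s.1 s.2 + s.1 w ∈ X) ∧
        ⟪s.1 s.2, n⟫_ℝ < 0)
    (hnc : ∀ s ∈ S, ∀ t ∈ S, s ≠ t →
      (t.1 : EuclideanSpace ℝ (Fin 3) → EuclideanSpace ℝ (Fin 3)) '' ↑fccSlots ≠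
        (s.1 : EuclideanSpace ℝ (Fin 3) → EuclideanSpace ℝ (Fin 3)) '' ↑fccSlots ∧
      ∀ n : EuclideanSpace ℝ (Fin 3), ‖n‖ = 1 →
        (∀ w ∈ fccSlots, ⟪s.1 w, n⟫_ℝ = 0 ∨ ⟪s.1 w, n⟫_ℝ = Real.sqrt (2 / 3) ∨ ⟪s.1 w, n⟫_ℝ = -Real.sqrt (2 / 3)) →
        (t.1 : EuclideanSpace ℝ (Fin 3) → EuclideanSpace ℝ (Fin 3)) '' ↑fccSlots ≠
          (fun x => s.1 x - (2 * ⟪s.1 x, n⟫_ℝ) • n) '' ↑fccSlots) :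
    (X.filter fun q => dist b q = 1).card + S.card ≤ 12 := by
  have hr : 0 < Real.sqrt (2 / 3) := Real.sqrt_pos.2 (by norm_num)
  -- non-co-axiality in the Barlow sense
  have hncB : ∀ s ∈ S, ∀ t ∈ S, s ≠ t →
      ¬ ∃ (L : EuclideanSpace ℝ (Fin 3) ≃ₗᵢ[ℝ] EuclideanSpace ℝ (Fin 3))
        (s₁ s₂ : EuclideanSpace ℝ (Fin 3)) (σ σ' : ℤ → ℤ), IsHaggSeq σ ∧ IsHaggSeq σ' ∧
        s.1 '' fccStacking 1 (Real.sqrt (2 / 3)) ⊆ (fun p => L p + s₁) '' barlowStacking 1 (Real.sqrt (2 / 3)) σ ∧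
        t.1 '' fccStacking 1 (Real.sqrt (2 / 3)) ⊆ (fun p => L p + s₂) '' barlowStacking 1 (Real.sqrt (2 / 3)) σ' := by
    intro s hs t ht hst hco
    obtain ⟨h1, h2⟩ := hnc s hs t ht hst
    rcases slots_eq_or_mirror_of_coaxial s.1 t.1 hco with h | ⟨n, hn, hmenu, h⟩
    · exact h1 h
    · exact h2 n hn hmenu h
  -- owned stars (full shell, or cross reading: the star slots lie in the own closed half)
  have hown : ∀ s ∈ S, ∀ w ∈ fccSlots, ⟪w, s.2⟫_ℝ < 0 → b + s.1 w ∈ X := by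
    intro s hs w hw hneg
    obtain ⟨hu, hp⟩ := hS s hs
    have hstar : ∀ t ∈ fccSlots, ⟪t, s.2⟫_ℝ = -(1 / 2) → b + s.1 t ∈ X := by
      intro t ht htu
      have hts : s.2 + t ∈ fccSlots := add_mem_fccSlots_of_inner_eq_neg_half hu ht (by rw [real_inner_comm]; exact htu)
      have e : b - s.1 s.2 + s.1 (s.2 + t) = b + s.1 t := by rw [map_add]; abel
      rcases hread s hs with hfull | ⟨n, hn, hmenu, hownh, hun⟩
      · have := hfull _ hts; rw [e] at this; exact this
      · have hun' : ⟪s.1 s.2, n⟫_ℝ = -Real.sqrt (2 / 3) := by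
          rcases hmenu s.2 hu with h | h | h
          · rw [h] at hun; exact absurd hun (lt_irrefl 0)
          · rw [h] at hun; linarith
          · exact h
        have hle : ⟪s.1 (s.2 + t), n⟫_ℝ ≤ 0 := by
          rw [map_add, inner_add_left, hun']
          rcases hmenu t ht with h | h | h <;> rw [h] <;> linarith
        have := hownh _ hts hle; rw [e] at this; exact this
    rcases inner_slots_mem hw hu with h | h | h | h | h
    · rw [h] at hneg; norm_num at hneg
    · rw [h] at hneg; norm_num at hneg
    · rw [h] at hneg; exact absurd hneg (lt_irrefl 0)
    · exact hstar w hw h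
    · have hw' : w = -s.2 := eq_neg_of_inner_eq_neg_one hu hw (by rw [real_inner_comm]; exact h)
      rw [hw', map_neg, ← sub_eq_add_neg]; exact hp
  -- pairwise cover and pairwise distinct stars
  have hcov : ∀ s ∈ S, ∀ t ∈ S, s ≠ t →
      ∀ q ∈ X, dist b q = 1 → q ∈ starSet b s.1 s.2 ∪ starSet b t.1 t.2 := by
    intro s hs t ht hst
    exact cover_of_starPair hSP hX (hS s hs).1 (hS t ht).1 hb (hown s hs) (hown t ht) (hncB s hs t ht hst)
  have hdiff : ∀ s ∈ S, ∀ t ∈ S, s ≠ t → starSet b s.1 s.2 ≠ starSet b t.1 t.2 := by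
    intro s hs t ht hst hEq
    exact hncB s hs t ht hst (coaxial_of_starSet_eq (hS s hs).1 hEq)
  have hdeg : (X.filter fun q => dist b q = 1).card ≤ 11 := by
    obtain ⟨s, hs, t, ht, hst⟩ := Finset.one_lt_card.1 (by omega : 1 < S.card)
    have hsub : (X.filter fun q => dist b q = 1) ⊆ starSet b s.1 s.2 ∪ starSet b t.1 t.2 := by
      intro q hq
      obtain ⟨hqX, hqd⟩ := mem_filter.1 hq
      exact hcov s hs t ht hst q hqX hqd
    have := (card_le_card hsub).trans (card_union_le _ _)
    rw [card_starSet b s.1 (hS s hs).1, card_starSet b t.1 (hS t ht).1] at this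
    omega
  exact card_contacts_add_card_le_twelve hdeg S (fun s hs => (hS s hs).1) hown hdiff hcov

end Summit.Ventures.Crystal3D.Theorems

end
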